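import Summits.BirchSwinnertonDyer.BirchSwinnertonDyer.Theorems.ClassRecordThreeIMCDivAtThreeB
import Summits.BirchSwinnertonDyer.Rank1Residual.X1.UnrSeriesFirstUnitCoeff
import Summits.BirchSwinnertonDyer.BirchSwinnertonDyer.Theses.ClassRecordThree
import Summits.BirchSwinnertonDyer.BirchSwinnertonDyer.Theses.KolyvaginRoadThree
import HarnessLib

/-!
# X11b @ `p = 3`, H3ᴮ@3 — ROAD B12 «λ-MATCHING TRANSFER»: the oriented BDP-side divisibility
# `Three.IMCDivAt₃B W` (items 20262 `IMCDivTwoLociAtThreeR` ∕ 20263 `IMCDivTwoLociTamAtThreeR`,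
# parents 20194 ∕ 20253) from ONE RATIONAL UPPER divisibility + matching Iwasawa invariants — the
# composition is kernel, and in fact gives the EQUALITY of ideals

Cell `bsd-stepL` (run/shared/lean/pub/bsd-stepL/), seat `bsd-stepL-bdp` (prover g17, 2026-08-27;
H3ᴮ@3 hand per plan g30 staffing 05:32:37Z). `--supports stmt-BirchSwinnertonDyer-20262 --as helper`.
THEOREMS ONLY (no definition, no named fact, no `sorry`). Memo: HOME/proof/PROOF-BDP.md §37 (ROAD B12).

## The road (why this composition is the right cut for H3ᴮ at `3 ∥ N`)

H3ᴮ = `Ch_Λ(X_ac^∅(E/K_∞⁻) at 𝔭bar)·R₀⟦T⟧ ⊆ (L_𝔭)` is the EISENSTEIN-side (lower-bound-on-Selmer)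
inclusion of the BDP anticyclotomic main conjecture; no Eisenstein-congruence engine exists in print at
`p = 3` (Wan 2020, Castella 2018 Thm. 4.4, Fouquet–Wan 4.41: `p ≥ 5`), and Kolyvagin-primitivity
(W. Zhang) needs BD-admissible primes, VOID at `3` (TARGET §3 T5). ROAD B12 reaches the SAME inclusion
from the OTHER side, by the Greenberg–Vatsal ∕ Emerton–Pollack–Weston mechanism transposed to the BDP
setting (printed templates: Lei–Müller–Xia, Forum Math. 2023 = arXiv:2302.06553 Thm. 1 (algebraic
`λ`∕`μ` under congruences, `p ∤ N₁N₂`, (H0)); arXiv:2503.00247 (2025) Thm. A (analytic congruence of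
Euler-modified BDP `p`-adic `L`-functions mod `ϖ^m`) and Thm. 7.5 («IMC for `f₁` + `μ = 0` + congruence
+ ONE divisibility `𝓛_𝔭(f₂)² ∈ Char(X_𝔭(f₂))` ⟹ IMC for `f₂`»)): at a `3`-congruent GOOD ORDINARY
partner `E′` (they abound: `X_E(3) ≅ ℙ¹`, Rubin–Silverberg) the BDP main conjecture at `p = 3` IS
refereed print — Yan–Zhu, J. Algebra 693 (2026) Thm. 5.7 (1), tree fact
`YanZhu2026.thm57_isTorsion_charIdealXGr_eq_bdpLFunction` («`p > 2` good ordinary», (Heeg), (spl),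
`ρ̄_E|_{G_K}` irreducible; integral under full `3`-adic image) — so `λ(X) = λ(L)` and `μ(X) = μ(L) = 0`
transfer to `E` through `E[3] ≅ E′[3]` (Σ-imprimitive objects depend on `ρ̄` only; the Euler factors
at `ℓ ∣ N N′` are the SAME power series on both sides), and then ONE divisibility for `E` — the
EULER-SYSTEM-side (upper bound, «`X` no larger than `L`») inclusion `(L) ⊆ Ch·R₀⟦T⟧`, even only
RATIONALLY (`∃ k, 3^k·L ∈ Ch·R₀⟦T⟧`) — forces EQUALITY, hence H3ᴮ. This file is the kernel certificate
of that last step, pointwise over the binders of the atom `Three.IMCDivAt₃B`, using the `R₀⟦T⟧`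
algebra of class X1 (`X1.KellerYinHalves.span_singleton_eq_of_C_pow_mul_mem`: one divisibility after
inverting `p` + `μ = 0` + equal `λ` ⟹ equal ideals; Washington Prop. 7.2) and the principality of
characteristic ideals of `Λ`-modules (`charIdeal_isPrincipal_holds`, Washington §13.2).

* §1 `charIdeal_map_eq_span_of_ratUpperBound_of_firstUnitCoeff` (+ `exists_charIdeal_eq_span`) — pure algebra: for a `Λ`-module
  `X`, `L ∈ R₀⟦T⟧`, a generator `g` of `Ch_Λ(X)` with the first UNIT coefficient of `g` (read in `R₀`)
  and of `L` at the same index `n` («`μ = 0`, `λ = n`» on both sides), and `3^k·L ∈ Ch·R₀⟦T⟧`: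
  `Ch·R₀⟦T⟧ = (L)`.
* §2 `Three.imcDivAt₃B_of_ratUpperBound_of_invariantsMatch` — the atom `Three.IMCDivAt₃B W` from the
  two B12 stub shapes over the atom's own binders (UB₃: rational upper divisibility; INV₃: a generator
  of `Ch_Λ(X_ac 𝔭bar)` and the frame's `L` have `μ = 0` and the same `λ`), and
  `Three.charIdeal_map_eq_span_of_…` — the EQUALITY at the same data (the full BDP main conjecture
  there, both inclusions).
* §3 by name: `imcDivTwoLociAtThreeR_of_forall_surj` (item 20262 ⟸ the atom on `Surj ∖ (Ram ∧ ¬split@3)`),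
  `imcDivTwoLociTamAtThreeR_of_imcDivTwoLociAtThreeR` (item 20263 ⟸ item 20262: ONE proof obligation
  serves both routes), `imcDivTwoLociAtThreeR_of_ratUpperBound_of_invariantsMatch` (item 20262 ⟸ the
  two B12 stub shapes class-wide on that locus) and its KOLY twin.

HONEST FRAMING: implications only. UB₃ (a `Λ`-adic Heegner-class upper bound at `3 ∥ N` + the
`Λ`-adic explicit reciprocity law at `3 ∥ N`) is NOT in print at `p = 3` (Howard 2007 `p ∤ 6N`;
Castella arXiv:2409.01360 Thm. 2.2 `p ≥ 5`, PRE); INV₃'s transfer from a congruent good-ordinary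
partner needs the `p ∣ N` versions of LMX23 Thm. 1 ∕ arXiv:2503.00247 Thm. A (printed for `p ∤ N`
only) and a partner `E′` Heegner for the SAME `K` — memo §37 lists every brick with its status.
Nothing is discharged, booked or re-labelled (T7); O2 stays OPEN; BSD(E,3) is proved for no class.

References: [Washington1997] Prop. 7.2, §13.2; [LeiMullerXia2023] = arXiv:2302.06553, Thm. 1,
Lemma «lambda-invariants»; arXiv:2503.00247 (2025), Thm. A, Thm. 7.5; [YanZhu2026] J. Algebra 693,
Thm. 5.7 (1); [GreenbergVatsal2000] §2; [EmertonPollackWeston2006] Thm. 1; [BurungaleCastellaSkinner2025]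
IMRN 2025 Thm. 1.2.4, Prop. 4.2.2; [Castella2018] Thm. 2.3, §2.2; cell audit ORIENT-AUDIT-19270 (form (a)).
-/

set_option autoImplicit false
set_option linter.dupNamespace false

noncomputable section

open scoped Classical

open WeierstrassCurve NumberField IsDedekindDomain Field PowerSeries
  Literature.NumberTheory.EllipticCurves Literature.NumberTheory.EllipticCurves.ModularForms
  Literature.NumberTheory.EllipticCurves.Rank1Residual
  Literature.NumberTheory.GaloisRepresentations
  Summit.BirchSwinnertonDyer.Rank1Residual Summit.BirchSwinnertonDyer.Rank1Residual.X11b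
  Summit.BirchSwinnertonDyer.Rank1Residual.X11b.AcSelmer
  Summit.BirchSwinnertonDyer.Rank1Residual.X11b.CongruenceLimit
  Summit.BirchSwinnertonDyer.Rank1Residual.X11b.Halves
  Summit.BirchSwinnertonDyer.Rank1Residual.X1.KellerYinHalves

/-! ### §1 The algebra of λ-matching in `R₀⟦T⟧` over a `Λ`-module's characteristic ideal -/

namespace Summit.BirchSwinnertonDyer.BirchSwinnertonDyer.Theorems.LambdaMatchingAtThree

/-- **λ-matching ⟹ EQUALITY of ideals** (Greenberg–Vatsal ∕ Emerton–Pollack–Weston's last step, in the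
receptacle `R₀⟦T⟧` of the BDP `p`-adic `L`-function): if `Ch_Λ(X) = (g)`, the images of `g` and `L` in
`R₀⟦T⟧` both have `μ = 0` with their first unit coefficient at the same index `n` (`λ = n`), and ONE
divisibility holds after inverting `p` (`p^k · L ∈ Ch_Λ(X)·R₀⟦T⟧`), then `Ch_Λ(X)·R₀⟦T⟧ = (L)`.
Pure algebra: `X1.KellerYinHalves.span_singleton_eq_of_C_pow_mul_mem`.
[cite: Washington1997, §7.1 Prop. 7.2 and §13.2] [cite: EmertonPollackWeston2006, Thm. 1 (the mechanism)] -/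
theorem charIdeal_map_eq_span_of_ratUpperBound_of_firstUnitCoeff {p : ℕ} [Fact p.Prime]
    {X : Type*} [AddCommGroup X] [Module (IwasawaAlgebra p) X] {g : IwasawaAlgebra p}
    (hg : Literature.NumberTheory.EllipticCurves.Module.charIdeal (IwasawaAlgebra p) X = Ideal.span {g})
    {L : UnrSeries p} {k n : ℕ}
    (hUB : C (((p : ℕ) : unrIntegers p) ^ k) * L ∈
      (Literature.NumberTheory.EllipticCurves.Module.charIdeal (IwasawaAlgebra p) X).map
        (PowerSeries.map (toUnr p)))
    (hFg : ‖((coeff n (PowerSeries.map (toUnr p) g) : unrIntegers p) : ℂ_[p])‖ = 1 ∧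
      ∀ i < n, ‖((coeff i (PowerSeries.map (toUnr p) g) : unrIntegers p) : ℂ_[p])‖ < 1)
    (hFL : ‖((coeff n L : unrIntegers p) : ℂ_[p])‖ = 1 ∧
      ∀ i < n, ‖((coeff i L : unrIntegers p) : ℂ_[p])‖ < 1) :
    (Literature.NumberTheory.EllipticCurves.Module.charIdeal (IwasawaAlgebra p) X).map
        (PowerSeries.map (toUnr p)) = Ideal.span {L} := by
  have hmap : (Literature.NumberTheory.EllipticCurves.Module.charIdeal (IwasawaAlgebra p) X).map
      (PowerSeries.map (toUnr p)) = Ideal.span {PowerSeries.map (toUnr p) g} := by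
    rw [hg, Ideal.map_span, Set.image_singleton]
  rw [hmap] at hUB ⊢
  exact span_singleton_eq_of_C_pow_mul_mem hUB hFg hFL

/-- **Every characteristic ideal has a generator** (`Λ = ℤ_p⟦T⟧` is a UFD; tree
`charIdeal_isPrincipal_holds`). [cite: Washington1997, §13.2] -/
theorem exists_charIdeal_eq_span (p : ℕ) [Fact p.Prime] (X : Type*) [AddCommGroup X]
    [Module (IwasawaAlgebra p) X] :
    ∃ g : IwasawaAlgebra p,
      Literature.NumberTheory.EllipticCurves.Module.charIdeal (IwasawaAlgebra p) X = Ideal.span {g} := by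
  obtain ⟨g, hg⟩ := (Literature.NumberTheory.EllipticCurves.charIdeal_isPrincipal_holds p X).principal
  exact ⟨g, hg⟩

end Summit.BirchSwinnertonDyer.BirchSwinnertonDyer.Theorems.LambdaMatchingAtThree

/-! ### §2 The atom `Three.IMCDivAt₃B W` from UB₃ + INV₃ (pointwise over the atom's binders) -/

namespace Summit.BirchSwinnertonDyer.Rank1Residual.X11b.Three

open Summit.BirchSwinnertonDyer.BirchSwinnertonDyer.Theorems.LambdaMatchingAtThree

variable {W : WeierstrassCurve ℚ}

/-- **ROAD B12 at `3 ∥ N`: the EQUALITY `Ch_Λ(X_ac 𝔭bar)·R₀⟦T⟧ = (L)` at every datum ∕ frame of the atom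
`Three.IMCDivAt₃B W`** from the two stub shapes over the SAME binders: UB₃ — ONE divisibility on the
Euler-system side after inverting `3` (`∃ k, 3^k·L ∈ Ch·R₀⟦T⟧`); INV₃ — a generator `g` of
`Ch_Λ(X_ac 𝔭bar)` and the frame's `L` have `μ = 0` and their first unit coefficient at the same index
(equal `λ`). CONDITIONAL on both; nothing asserted. [cite: Washington1997, §7.1 Prop. 7.2 and §13.2]
[cite: EmertonPollackWeston2006, Thm. 1 (mechanism)] [cite: Castella2018, Thm. 2.3 and §2.2 (arXiv:1704.06608 p. 5) (the objects)] -/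
theorem charIdeal_map_eq_span_of_ratUpperBound_of_invariantsMatch
    (hUB : ∀ (N : ℕ) [NeZero N] (K : Type) [Field K] [NumberField K] (Dt : ModularParametrizationData W N)
      (H : HeegnerDatum N (NumberField.discr K)) (ι : K →+* ℂ) (P : (W.baseChange K).toAffine.Point),
      ClassX11b W 3 → Surj W 3 → W.conductorNorm ℤ = N → IsImaginaryQuadratic K →
      Odd (NumberField.discr K) → SatisfiesHeegnerHypothesis N K →
      (W.quadraticTwist (NumberField.discr K : ℚ)).entireLFunction 1 ≠ 0 →
      WeierstrassCurve.Affine.Point.map ι.toRatAlgHom P = heegnerPointComplex Dt H →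
      ¬ (3 : ℤ) ∣ Dt.c → ¬ IsOfFinAddOrder P →
      ∀ (κ : ZpExtension K 3), κ.IsAnticyclotomic →
        ∀ (γ : Field.absoluteGaloisGroup K) [Fact (κ.IsTopGenerator γ)]
          (𝔭 : HeightOneSpectrum (𝓞 K)), ((3 : ℕ) : 𝓞 K) ∈ 𝔭.asIdeal →
          𝔭.asIdeal.ramificationIdx (𝓞 ℚ) = 1 → 𝔭.asIdeal.inertiaDeg (𝓞 ℚ) = 1 →
          ∀ (f : CuspForm (CongruenceSubgroup.Gamma0 N) 2), IsNewformOf W f →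
            ∀ (ι' : PadicAlgCl 3 ≃+* ℂ), InducesPrime ι' 𝔭 →
              ∀ (ΩK : ℂ) (Ωp : (unrIntegers 3)ˣ) (L : UnrSeries 3), ΩK ≠ 0 →
                IsBDPLFunction ι' 𝔭 κ γ f ΩK ((Ωp : unrIntegers 3) : ℂ_[3]) L →
                  ∀ (𝔭bar : HeightOneSpectrum (𝓞 K)), ((3 : ℕ) : 𝓞 K) ∈ 𝔭bar.asIdeal → 𝔭bar ≠ 𝔭 →
                    ∃ k : ℕ, C (((3 : ℕ) : unrIntegers 3) ^ k) * L ∈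
                      (XAc.charIdeal (W.baseChange K) 3 κ 𝔭bar ∅ γ).map (PowerSeries.map (toUnr 3)))
    (hINV : ∀ (N : ℕ) [NeZero N] (K : Type) [Field K] [NumberField K] (Dt : ModularParametrizationData W N)
      (H : HeegnerDatum N (NumberField.discr K)) (ι : K →+* ℂ) (P : (W.baseChange K).toAffine.Point),
      ClassX11b W 3 → Surj W 3 → W.conductorNorm ℤ = N → IsImaginaryQuadratic K →
      Odd (NumberField.discr K) → SatisfiesHeegnerHypothesis N K →
      (W.quadraticTwist (NumberField.discr K : ℚ)).entireLFunction 1 ≠ 0 →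
      WeierstrassCurve.Affine.Point.map ι.toRatAlgHom P = heegnerPointComplex Dt H →
      ¬ (3 : ℤ) ∣ Dt.c → ¬ IsOfFinAddOrder P →
      ∀ (κ : ZpExtension K 3), κ.IsAnticyclotomic →
        ∀ (γ : Field.absoluteGaloisGroup K) [Fact (κ.IsTopGenerator γ)]
          (𝔭 : HeightOneSpectrum (𝓞 K)), ((3 : ℕ) : 𝓞 K) ∈ 𝔭.asIdeal →
          𝔭.asIdeal.ramificationIdx (𝓞 ℚ) = 1 → 𝔭.asIdeal.inertiaDeg (𝓞 ℚ) = 1 →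
          ∀ (f : CuspForm (CongruenceSubgroup.Gamma0 N) 2), IsNewformOf W f →
            ∀ (ι' : PadicAlgCl 3 ≃+* ℂ), InducesPrime ι' 𝔭 →
              ∀ (ΩK : ℂ) (Ωp : (unrIntegers 3)ˣ) (L : UnrSeries 3), ΩK ≠ 0 →
                IsBDPLFunction ι' 𝔭 κ γ f ΩK ((Ωp : unrIntegers 3) : ℂ_[3]) L →
                  ∀ (𝔭bar : HeightOneSpectrum (𝓞 K)), ((3 : ℕ) : 𝓞 K) ∈ 𝔭bar.asIdeal → 𝔭bar ≠ 𝔭 →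
                    ∃ (g : IwasawaAlgebra 3) (n : ℕ),
                      XAc.charIdeal (W.baseChange K) 3 κ 𝔭bar ∅ γ = Ideal.span {g} ∧
                      (‖((coeff n (PowerSeries.map (toUnr 3) g) : unrIntegers 3) : ℂ_[3])‖ = 1 ∧
                        ∀ i < n, ‖((coeff i (PowerSeries.map (toUnr 3) g) : unrIntegers 3) : ℂ_[3])‖ < 1) ∧
                      (‖((coeff n L : unrIntegers 3) : ℂ_[3])‖ = 1 ∧
                        ∀ i < n, ‖((coeff i L : unrIntegers 3) : ℂ_[3])‖ < 1))
    (N : ℕ) [NeZero N] (K : Type) [Field K] [NumberField K] (Dt : ModularParametrizationData W N)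
    (H : HeegnerDatum N (NumberField.discr K)) (ι : K →+* ℂ) (P : (W.baseChange K).toAffine.Point)
    (hX : ClassX11b W 3) (hsurj : Surj W 3) (hN : W.conductorNorm ℤ = N) (hK : IsImaginaryQuadratic K)
    (hodd : Odd (NumberField.discr K)) (hheeg : SatisfiesHeegnerHypothesis N K)
    (hL1 : (W.quadraticTwist (NumberField.discr K : ℚ)).entireLFunction 1 ≠ 0)
    (hP : WeierstrassCurve.Affine.Point.map ι.toRatAlgHom P = heegnerPointComplex Dt H)
    (hc : ¬ (3 : ℤ) ∣ Dt.c) (hP0 : ¬ IsOfFinAddOrder P) (κ : ZpExtension K 3) (hκ : κ.IsAnticyclotomic)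
    (γ : Field.absoluteGaloisGroup K) [Fact (κ.IsTopGenerator γ)]
    (𝔭 : HeightOneSpectrum (𝓞 K)) (h𝔭 : ((3 : ℕ) : 𝓞 K) ∈ 𝔭.asIdeal)
    (he : 𝔭.asIdeal.ramificationIdx (𝓞 ℚ) = 1) (hf : 𝔭.asIdeal.inertiaDeg (𝓞 ℚ) = 1)
    (f : CuspForm (CongruenceSubgroup.Gamma0 N) 2) (hfW : IsNewformOf W f)
    (ι' : PadicAlgCl 3 ≃+* ℂ) (hι' : InducesPrime ι' 𝔭) (ΩK : ℂ) (Ωp : (unrIntegers 3)ˣ) (L : UnrSeries 3)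
    (hΩK : ΩK ≠ 0) (hL : IsBDPLFunction ι' 𝔭 κ γ f ΩK ((Ωp : unrIntegers 3) : ℂ_[3]) L)
    (𝔭bar : HeightOneSpectrum (𝓞 K)) (h𝔭bar : ((3 : ℕ) : 𝓞 K) ∈ 𝔭bar.asIdeal) (hne : 𝔭bar ≠ 𝔭) :
    (XAc.charIdeal (W.baseChange K) 3 κ 𝔭bar ∅ γ).map (PowerSeries.map (toUnr 3)) = Ideal.span {L} := by
  obtain ⟨k, hk⟩ := hUB N K Dt H ι P hX hsurj hN hK hodd hheeg hL1 hP hc hP0 κ hκ γ 𝔭 h𝔭 he hf f hfW ι'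
    hι' ΩK Ωp L hΩK hL 𝔭bar h𝔭bar hne
  obtain ⟨g, n, hg, hFg, hFL⟩ := hINV N K Dt H ι P hX hsurj hN hK hodd hheeg hL1 hP hc hP0 κ hκ γ 𝔭 h𝔭
    he hf f hfW ι' hι' ΩK Ωp L hΩK hL 𝔭bar h𝔭bar hne
  exact charIdeal_map_eq_span_of_ratUpperBound_of_firstUnitCoeff (X := XAc (W.baseChange K) 3 κ 𝔭bar ∅ γ)
    hg hk hFg hFL

/-- **ROAD B12 at `3 ∥ N`: the oriented H3 atom `Three.IMCDivAt₃B W` from UB₃ + INV₃** (the lower-bound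
inclusion is the shadow of the equality `charIdeal_map_eq_span_of_ratUpperBound_of_invariantsMatch`).
CONDITIONAL on both stub shapes (UB₃ unprinted at `p = 3`; INV₃ = transfer from a `3`-congruent good
ordinary partner where Yan–Zhu 2026 Thm. 5.7 (1) gives the equality — memo §37); nothing booked.
[cite: Washington1997, §7.1 Prop. 7.2 and §13.2] [cite: EmertonPollackWeston2006, Thm. 1 (mechanism)]
[cite: YanZhu2026, Thm. 5.7 (1) (J. Algebra 693; the partner's equality at p = 3)] -/
theorem imcDivAt₃B_of_ratUpperBound_of_invariantsMatch
    (hUB : ∀ (N : ℕ) [NeZero N] (K : Type) [Field K] [NumberField K] (Dt : ModularParametrizationData W N)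
      (H : HeegnerDatum N (NumberField.discr K)) (ι : K →+* ℂ) (P : (W.baseChange K).toAffine.Point),
      ClassX11b W 3 → Surj W 3 → W.conductorNorm ℤ = N → IsImaginaryQuadratic K →
      Odd (NumberField.discr K) → SatisfiesHeegnerHypothesis N K →
      (W.quadraticTwist (NumberField.discr K : ℚ)).entireLFunction 1 ≠ 0 →
      WeierstrassCurve.Affine.Point.map ι.toRatAlgHom P = heegnerPointComplex Dt H →
      ¬ (3 : ℤ) ∣ Dt.c → ¬ IsOfFinAddOrder P →
      ∀ (κ : ZpExtension K 3), κ.IsAnticyclotomic →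
        ∀ (γ : Field.absoluteGaloisGroup K) [Fact (κ.IsTopGenerator γ)]
          (𝔭 : HeightOneSpectrum (𝓞 K)), ((3 : ℕ) : 𝓞 K) ∈ 𝔭.asIdeal →
          𝔭.asIdeal.ramificationIdx (𝓞 ℚ) = 1 → 𝔭.asIdeal.inertiaDeg (𝓞 ℚ) = 1 →
          ∀ (f : CuspForm (CongruenceSubgroup.Gamma0 N) 2), IsNewformOf W f →
            ∀ (ι' : PadicAlgCl 3 ≃+* ℂ), InducesPrime ι' 𝔭 →
              ∀ (ΩK : ℂ) (Ωp : (unrIntegers 3)ˣ) (L : UnrSeries 3), ΩK ≠ 0 →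
                IsBDPLFunction ι' 𝔭 κ γ f ΩK ((Ωp : unrIntegers 3) : ℂ_[3]) L →
                  ∀ (𝔭bar : HeightOneSpectrum (𝓞 K)), ((3 : ℕ) : 𝓞 K) ∈ 𝔭bar.asIdeal → 𝔭bar ≠ 𝔭 →
                    ∃ k : ℕ, C (((3 : ℕ) : unrIntegers 3) ^ k) * L ∈
                      (XAc.charIdeal (W.baseChange K) 3 κ 𝔭bar ∅ γ).map (PowerSeries.map (toUnr 3)))
    (hINV : ∀ (N : ℕ) [NeZero N] (K : Type) [Field K] [NumberField K] (Dt : ModularParametrizationData W N)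
      (H : HeegnerDatum N (NumberField.discr K)) (ι : K →+* ℂ) (P : (W.baseChange K).toAffine.Point),
      ClassX11b W 3 → Surj W 3 → W.conductorNorm ℤ = N → IsImaginaryQuadratic K →
      Odd (NumberField.discr K) → SatisfiesHeegnerHypothesis N K →
      (W.quadraticTwist (NumberField.discr K : ℚ)).entireLFunction 1 ≠ 0 →
      WeierstrassCurve.Affine.Point.map ι.toRatAlgHom P = heegnerPointComplex Dt H →
      ¬ (3 : ℤ) ∣ Dt.c → ¬ IsOfFinAddOrder P →
      ∀ (κ : ZpExtension K 3), κ.IsAnticyclotomic →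
        ∀ (γ : Field.absoluteGaloisGroup K) [Fact (κ.IsTopGenerator γ)]
          (𝔭 : HeightOneSpectrum (𝓞 K)), ((3 : ℕ) : 𝓞 K) ∈ 𝔭.asIdeal →
          𝔭.asIdeal.ramificationIdx (𝓞 ℚ) = 1 → 𝔭.asIdeal.inertiaDeg (𝓞 ℚ) = 1 →
          ∀ (f : CuspForm (CongruenceSubgroup.Gamma0 N) 2), IsNewformOf W f →
            ∀ (ι' : PadicAlgCl 3 ≃+* ℂ), InducesPrime ι' 𝔭 →
              ∀ (ΩK : ℂ) (Ωp : (unrIntegers 3)ˣ) (L : UnrSeries 3), ΩK ≠ 0 →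
                IsBDPLFunction ι' 𝔭 κ γ f ΩK ((Ωp : unrIntegers 3) : ℂ_[3]) L →
                  ∀ (𝔭bar : HeightOneSpectrum (𝓞 K)), ((3 : ℕ) : 𝓞 K) ∈ 𝔭bar.asIdeal → 𝔭bar ≠ 𝔭 →
                    ∃ (g : IwasawaAlgebra 3) (n : ℕ),
                      XAc.charIdeal (W.baseChange K) 3 κ 𝔭bar ∅ γ = Ideal.span {g} ∧
                      (‖((coeff n (PowerSeries.map (toUnr 3) g) : unrIntegers 3) : ℂ_[3])‖ = 1 ∧
                        ∀ i < n, ‖((coeff i (PowerSeries.map (toUnr 3) g) : unrIntegers 3) : ℂ_[3])‖ < 1) ∧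
                      (‖((coeff n L : unrIntegers 3) : ℂ_[3])‖ = 1 ∧
                        ∀ i < n, ‖((coeff i L : unrIntegers 3) : ℂ_[3])‖ < 1)) :
    IMCDivAt₃B W := by
  intro N _ K _ _ Dt H ι P hX hsurj hN hK hodd hheeg hL1 hP hc hP0 κ hκ γ _ 𝔭 h𝔭 he hf f hfW ι' hι'
    ΩK Ωp L hΩK hL 𝔭bar h𝔭bar hne
  exact (charIdeal_map_eq_span_of_ratUpperBound_of_invariantsMatch hUB hINV N K Dt H ι P hX hsurj hN hK
    hodd hheeg hL1 hP hc hP0 κ hκ γ 𝔭 h𝔭 he hf f hfW ι' hι' ΩK Ωp L hΩK hL 𝔭bar h𝔭bar hne).le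

end Summit.BirchSwinnertonDyer.Rank1Residual.X11b.Three

/-! ### §3 By name: items 20262 ∕ 20263 -/

namespace Summit.BirchSwinnertonDyer.BirchSwinnertonDyer.Theorems.LambdaMatchingAtThree

open Summit.BirchSwinnertonDyer.Rank1Residual.X11b.Three

/-- **Item 20262 `IMCDivTwoLociAtThreeR` ⟸ the atom on its honest locus.** The atom
`Three.IMCDivAt₃B W` is vacuous off `Surj W 3` (its own binder), so the two-loci item asks for it
exactly on `Surj` minus (ram ∧ non-split at 3) (the road-(a) Schneider locus). [folklore] -/
theorem imcDivTwoLociAtThreeR_of_forall_surj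
    (h : ∀ (W : WeierstrassCurve ℚ) [W.IsElliptic] [W.IsGloballyMinimal],
      ClassX11b W 3 → Surj W 3 → (Ram W 3 → W.HasSplitMultiplicativeReductionAtPrime 3) →
        Three.IMCDivAt₃B W) :
    Summit.BirchSwinnertonDyer.BirchSwinnertonDyer.Theses.ClassRecordThree.IMCDivTwoLociAtThreeR := by
  intro W _ _ hX
  refine ⟨fun hram hsplit ↦ ?_, fun hnr hsurj ↦ h W hX hsurj fun hram ↦ absurd hram hnr⟩
  intro N _ K _ _ Dt H ι P hX' hsurj
  exact h W hX hsurj (fun _ ↦ hsplit) N K Dt H ι P hX' hsurj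

/-- **Item 20263 `IMCDivTwoLociTamAtThreeR` (KOLY) ⟸ item 20262 `IMCDivTwoLociAtThreeR` (K2@3)**: the KOLY
item carries the extra binder `3 ∣ ∏ c_ℓ` on the ram branch, so ONE proof of the K2@3 item serves both
routes. [folklore] -/
theorem imcDivTwoLociTamAtThreeR_of_imcDivTwoLociAtThreeR
    (h : Summit.BirchSwinnertonDyer.BirchSwinnertonDyer.Theses.ClassRecordThree.IMCDivTwoLociAtThreeR) :
    Summit.BirchSwinnertonDyer.BirchSwinnertonDyer.Theses.KolyvaginRoadThree.IMCDivTwoLociTamAtThreeR := by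
  intro W _ _ hX
  obtain ⟨hr, hn⟩ := h W hX
  exact ⟨fun hram hsplit _ ↦ hr hram hsplit, hn⟩

/-- **Item 20262 along ROAD B12**: UB₃ + INV₃ class-wide on `Surj ∖ (ram ∧ non-split at 3)` ⟹
`IMCDivTwoLociAtThreeR` BY NAME (`imcDivAt₃B_of_ratUpperBound_of_invariantsMatch` under the loci
binders). CONDITIONAL; nothing booked. [cite: Washington1997, §7.1 Prop. 7.2 and §13.2]
[cite: EmertonPollackWeston2006, Thm. 1 (mechanism)] -/
theorem imcDivTwoLociAtThreeR_of_ratUpperBound_of_invariantsMatch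
    (hUB : ∀ (W : WeierstrassCurve ℚ) [W.IsElliptic] [W.IsGloballyMinimal],
      ClassX11b W 3 → Surj W 3 → (Ram W 3 → W.HasSplitMultiplicativeReductionAtPrime 3) →
      ∀ (N : ℕ) [NeZero N] (K : Type) [Field K] [NumberField K] (Dt : ModularParametrizationData W N)
      (H : HeegnerDatum N (NumberField.discr K)) (ι : K →+* ℂ) (P : (W.baseChange K).toAffine.Point),
      ClassX11b W 3 → Surj W 3 → W.conductorNorm ℤ = N → IsImaginaryQuadratic K →
      Odd (NumberField.discr K) → SatisfiesHeegnerHypothesis N K →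
      (W.quadraticTwist (NumberField.discr K : ℚ)).entireLFunction 1 ≠ 0 →
      WeierstrassCurve.Affine.Point.map ι.toRatAlgHom P = heegnerPointComplex Dt H →
      ¬ (3 : ℤ) ∣ Dt.c → ¬ IsOfFinAddOrder P →
      ∀ (κ : ZpExtension K 3), κ.IsAnticyclotomic →
        ∀ (γ : Field.absoluteGaloisGroup K) [Fact (κ.IsTopGenerator γ)]
          (𝔭 : HeightOneSpectrum (𝓞 K)), ((3 : ℕ) : 𝓞 K) ∈ 𝔭.asIdeal →
          𝔭.asIdeal.ramificationIdx (𝓞 ℚ) = 1 → 𝔭.asIdeal.inertiaDeg (𝓞 ℚ) = 1 →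
          ∀ (f : CuspForm (CongruenceSubgroup.Gamma0 N) 2), IsNewformOf W f →
            ∀ (ι' : PadicAlgCl 3 ≃+* ℂ), InducesPrime ι' 𝔭 →
              ∀ (ΩK : ℂ) (Ωp : (unrIntegers 3)ˣ) (L : UnrSeries 3), ΩK ≠ 0 →
                IsBDPLFunction ι' 𝔭 κ γ f ΩK ((Ωp : unrIntegers 3) : ℂ_[3]) L →
                  ∀ (𝔭bar : HeightOneSpectrum (𝓞 K)), ((3 : ℕ) : 𝓞 K) ∈ 𝔭bar.asIdeal → 𝔭bar ≠ 𝔭 →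
                    ∃ k : ℕ, C (((3 : ℕ) : unrIntegers 3) ^ k) * L ∈
                      (XAc.charIdeal (W.baseChange K) 3 κ 𝔭bar ∅ γ).map (PowerSeries.map (toUnr 3)))
    (hINV : ∀ (W : WeierstrassCurve ℚ) [W.IsElliptic] [W.IsGloballyMinimal],
      ClassX11b W 3 → Surj W 3 → (Ram W 3 → W.HasSplitMultiplicativeReductionAtPrime 3) →
      ∀ (N : ℕ) [NeZero N] (K : Type) [Field K] [NumberField K] (Dt : ModularParametrizationData W N)
      (H : HeegnerDatum N (NumberField.discr K)) (ι : K →+* ℂ) (P : (W.baseChange K).toAffine.Point),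
      ClassX11b W 3 → Surj W 3 → W.conductorNorm ℤ = N → IsImaginaryQuadratic K →
      Odd (NumberField.discr K) → SatisfiesHeegnerHypothesis N K →
      (W.quadraticTwist (NumberField.discr K : ℚ)).entireLFunction 1 ≠ 0 →
      WeierstrassCurve.Affine.Point.map ι.toRatAlgHom P = heegnerPointComplex Dt H →
      ¬ (3 : ℤ) ∣ Dt.c → ¬ IsOfFinAddOrder P →
      ∀ (κ : ZpExtension K 3), κ.IsAnticyclotomic →
        ∀ (γ : Field.absoluteGaloisGroup K) [Fact (κ.IsTopGenerator γ)]
          (𝔭 : HeightOneSpectrum (𝓞 K)), ((3 : ℕ) : 𝓞 K) ∈ 𝔭.asIdeal →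
          𝔭.asIdeal.ramificationIdx (𝓞 ℚ) = 1 → 𝔭.asIdeal.inertiaDeg (𝓞 ℚ) = 1 →
          ∀ (f : CuspForm (CongruenceSubgroup.Gamma0 N) 2), IsNewformOf W f →
            ∀ (ι' : PadicAlgCl 3 ≃+* ℂ), InducesPrime ι' 𝔭 →
              ∀ (ΩK : ℂ) (Ωp : (unrIntegers 3)ˣ) (L : UnrSeries 3), ΩK ≠ 0 →
                IsBDPLFunction ι' 𝔭 κ γ f ΩK ((Ωp : unrIntegers 3) : ℂ_[3]) L →
                  ∀ (𝔭bar : HeightOneSpectrum (𝓞 K)), ((3 : ℕ) : 𝓞 K) ∈ 𝔭bar.asIdeal → 𝔭bar ≠ 𝔭 →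
                    ∃ (g : IwasawaAlgebra 3) (n : ℕ),
                      XAc.charIdeal (W.baseChange K) 3 κ 𝔭bar ∅ γ = Ideal.span {g} ∧
                      (‖((coeff n (PowerSeries.map (toUnr 3) g) : unrIntegers 3) : ℂ_[3])‖ = 1 ∧
                        ∀ i < n, ‖((coeff i (PowerSeries.map (toUnr 3) g) : unrIntegers 3) : ℂ_[3])‖ < 1) ∧
                      (‖((coeff n L : unrIntegers 3) : ℂ_[3])‖ = 1 ∧
                        ∀ i < n, ‖((coeff i L : unrIntegers 3) : ℂ_[3])‖ < 1)) :
    Summit.BirchSwinnertonDyer.BirchSwinnertonDyer.Theses.ClassRecordThree.IMCDivTwoLociAtThreeR :=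
  imcDivTwoLociAtThreeR_of_forall_surj fun W _ _ hX hsurj hloc ↦
    imcDivAt₃B_of_ratUpperBound_of_invariantsMatch (hUB W hX hsurj hloc) (hINV W hX hsurj hloc)

end Summit.BirchSwinnertonDyer.BirchSwinnertonDyer.Theorems.LambdaMatchingAtThree

end
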